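import Literature.AnabelianGeometry.AbsoluteAnabelian.AbsTopIProp410Sub
import Literature.AnabelianGeometry.AbsoluteAnabelian.AbsTopI.CoFreeCompletionFunctorial
import HarnessLib

/-!
# [AbsTopI] Prop 4.10 (iii)/(v): the sub-DAG kits INSTANTIATED at the co-free completion of §0

S. Mochizuki, *Topics in Absolute Anabelian Geometry I* [AbsTopI] (2012), §0 p. 8 and Prop 4.10
(iii)–(v) pp. 60–61 (manuscript pagination, lit key `paper:url-11ac98ba15fc`).  The statements-first
sub-DAG `AbsTopIProp410Sub.lean` (abc-iut-w5-d025, p414417) types (iii)/(v) over two RECORDS of the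
outputs of the `(Q, Δ)`-co-free completion — `CoFreeQKit` (the completion of `Π^tp_X` w.r.t. a quotient
`q : Π̂_X → Q`, with `H ↦ H^{co-fr}`) and `CoFreeLKit` (the family `(H, l) ↦ H[l]` with the action of
normalisers) — marked TODO-merge:abc-iut-L4-t13.  This file performs that merge: it INSTANTIATES both
kits at the REAL construction (`AbsTopI/CofreeCore.lean`, `CoFreeCompletion.lean`,
`CoFreeCompletionDense.lean`, `CoFreeCompletionFunctorial.lean`, abc-iut-L4-t13):

* `CoFreeQKit.ofConstruction X q` : `C := CoFreeCompletion (q ∘ toHat) Δ^tp_X`, `η := ` the natural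
  dense homomorphism, `coFr := cofreeCore` (= `H^{co-fr}` whenever a minimal co-free subgroup exists);
* `CoFreeLKit.ofConstruction X` : `Hl H l := H[l] = CoFreeProL (H → Ĥ) l` with `Ĥ :=` the closure of
  `toHat(H)` in `Π̂_X` ([SemiAnbd] p. 73 "`∧` = closure in `Π_{X_K}`"), `η :=` the natural map, and
  `conjAct j` := the automorphism INDUCED (functoriality, `Equivariance.congrHom`) by conjugation by
  `j ∈ N(H)` on `H` and by `toHat j` on `Ĥ^{(l)}`; the kit's two laws `conjAct_η`, `conjAct_inner` are
  THEOREMS (`Equivariance.congrHom_toCoFreeCompletion`, `Equivariance.congrHom_eq_conj_of`);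
* the node statements AT THE CONSTRUCTION, by name (audit note w5-d210 N1: the sub-DAG's node
  statements are kit-relative; their content is fixed by plugging THIS kit): `Prop410iiiAt`,
  `Prop410iiiDeltaAt`, `SelfCompletionAt`, `Prop410vAt`, the row `CoFreeCofinalAlong`'s
  monotonicity conjunct DISCHARGED at the construction (`cofreeCore_mono`, Nielsen–Schreier), and the
  PRINT-FAITHFUL image form `CoFreeCofinalImAlong` of its cofinality conjunct (finding F-w5d011-1:
  the preimage form as typed is suspect-too-strong; it is not consumed here).

Nothing is asserted: the node statements remain named `Prop`s (model-relative; the tempered `π₁` is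
abc-iut-L3's interface).  HONEST FRAMING: refereed prerequisite papers; no bearing on [IUTchIII]
Cor 3.12; typed ≠ proved.
-/

noncomputable section

open Topology

namespace Literature.AnabelianGeometry.AbsoluteAnabelian.AbsTopI.Prop410

open Literature.AnabelianGeometry.SemiGraphs
open Literature.AnabelianGeometry.AbsoluteAnabelian.AbsTopI

variable {p : ℕ} [Fact p.Prime]

/-! ### The `Q`-kit at the construction -/

/-- **`CoFreeQKit` INSTANTIATED**: the `(Q, Δ^tp_X)`-co-free completion of `Π^tp_X` along
`Π^tp_X → Π̂_X → Q` as constructed in `AbsTopI/CoFreeCompletion.lean`, with `coFr := cofreeCore`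
(`= H^{co-fr}` under [AbsTopI] §0 p. 8's hypothesis, `cofreeCore_eq_of_isMinimalCofreeIn`).
Closes TODO-merge:abc-iut-L4-t13 of `AbsTopIProp410Sub.lean`. [cite: MochizukiAbsTopI2012, §0 p.8] -/
def CoFreeQKit.ofConstruction (X : TemperedCurve p) (Q : Type) [Group Q] [TopologicalSpace Q]
    [IsTopologicalGroup Q] (q : X.PiHat →ₜ* Q) : CoFreeQKit X Q q where
  C := CoFreeCompletion (q.comp X.toHat) X.DeltaTemp
  η := toCoFreeCompletion (q.comp X.toHat) X.DeltaTemp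
  coFr := cofreeCore
  coFr_le := cofreeCore_le

/-- At the construction, `η` has dense image ([AbsTopI] §0 p. 8 "natural dense homomorphism").
[cite: MochizukiAbsTopI2012, §0 p.8] -/
theorem CoFreeQKit.denseRange_η_ofConstruction (X : TemperedCurve p) (Q : Type) [Group Q]
    [TopologicalSpace Q] [IsTopologicalGroup Q] (q : X.PiHat →ₜ* Q) :
    DenseRange (CoFreeQKit.ofConstruction X Q q).η :=
  denseRange_toCoFreeCompletion _ _

/-- At the construction, `coFr` is monotone (the second conjunct of row `CoFreeCofinalAlong`,
DISCHARGED: `cofreeCore_mono`, Nielsen–Schreier). [cite: MochizukiAbsTopI2012, §0 p.8] -/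
theorem CoFreeQKit.coFr_mono_ofConstruction (X : TemperedCurve p) (Q : Type) [Group Q]
    [TopologicalSpace Q] [IsTopologicalGroup Q] (q : X.PiHat →ₜ* Q) {H₁ H₂ : Subgroup X.PiTemp}
    (h : H₁ ≤ H₂) :
    (CoFreeQKit.ofConstruction X Q q).coFr H₁ ≤ (CoFreeQKit.ofConstruction X Q q).coFr H₂ :=
  cofreeCore_mono h

/-- The two "characteristic" notions in play (audit note w5-d210 N1): the sub-DAG's
`IsCharOpenFiniteIndexInDelta X H` asks `H ∩ Δ^tp_X` to be characteristic for ALL group automorphisms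
of `Δ^tp_X` (Mathlib `Subgroup.Characteristic`), the construction's index set `CharOpenSubgroup Δ^tp_X`
only for the TOPOLOGICAL ones (`Δ ≃ₜ* Δ`) — the weaker requirement print needs.  The usable direction
of the comparison: every subgroup of the sub-DAG's family IS an index of the construction.
[cite: MochizukiAbsTopI2012, §0 p.8] -/
def charOpenSubgroupOf (X : TemperedCurve p) {H : Subgroup X.PiTemp}
    (h : IsCharOpenFiniteIndexInDelta X H) : CharOpenSubgroup X.DeltaTemp where
  toSubgroup := H
  le := h.1.1
  isOpen := h.1.2.1
  finiteIndex := h.1.2.2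
  map_eq α := (Subgroup.characteristic_iff_map_eq.mp h.2) α.toMulEquiv

/-- The index built from `H` has underlying subgroup `H`. [cite: MochizukiAbsTopI2012, §0 p.8] -/
@[simp] theorem toSubgroup_charOpenSubgroupOf (X : TemperedCurve p) {H : Subgroup X.PiTemp}
    (h : IsCharOpenFiniteIndexInDelta X H) : (charOpenSubgroupOf X h).toSubgroup = H := rfl

/-! ### [AbsTopI] Prop 4.10 (iii) at the construction -/

/-- **[AbsTopI] Prop 4.10 (iii) AT THE CONSTRUCTION** (node `AbsTopI:Prop4.10(iii)`, p. 60 l. 40–52,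
de-cuspidalization case): "the natural homomorphism `Π^tp_X → Π^tp_Y` [...] may be reconstructed [...]
as the natural morphism from `Π^tp_X` to the co-free completion of `Π^tp_X` with respect to `Π̂^tp_Y`"
— `Prop410iii` with the kit `CoFreeQKit.ofConstruction X Π̂_Y f̂`: there is an isomorphism
`(Π^tp_X)^{Π̂_Y/co-fr} ≃ₜ* Π^tp_Y` carrying `η` to `f`.  Named statement (model-relative: the tempered
`π₁` is abc-iut-L3's interface). [cite: MochizukiAbsTopI2012, Prop 4.10 (iii) p.60] -/
def Prop410iiiAt {X Y : TemperedCurve p} (E : DeCuspidalization X Y) : Prop :=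
  Prop410iii E (CoFreeQKit.ofConstruction X Y.PiHat E.fHat)

/-- [AbsTopI] Prop 4.10 (iii), "respectively, `Δ^tp_X → Δ^tp_Y`", AT THE CONSTRUCTION.
[cite: MochizukiAbsTopI2012, Prop 4.10 (iii) p.60] -/
def Prop410iiiDeltaAt {X Y : TemperedCurve p} (E : DeCuspidalization X Y) : Prop :=
  Prop410iiiDelta E (CoFreeQKit.ofConstruction X Y.PiHat E.fHat)

/-- [AbsTopI] Prop 4.10 (i), last clause (p. 60 l. 45–47: "`π₁^tp(X)` [...] is naturally isomorphic
to its `π₁(X)`-co-free completion") AT THE CONSTRUCTION (`Q := Π̂_Z`, `q := id`).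
[cite: MochizukiAbsTopI2012, Prop 4.10 (i) p.60] -/
def SelfCompletionAt (Z : TemperedCurve p) : Prop :=
  SelfCompletion Z (CoFreeQKit.ofConstruction Z Z.PiHat (ContinuousMonoidHom.id Z.PiHat))

/-- Row iii.L05 (`CoFreeCofinalAlong`) AT THE CONSTRUCTION is EQUIVALENT to its first (cofinality)
conjunct: the second (monotonicity of `H ↦ H^{co-fr}`) is the theorem `cofreeCore_mono`
(Nielsen–Schreier).  NOTE (finding F-w5d011-1, L4-lead RULINGS #3 (4)(iv)): conjunct 1 AS TYPED in
`AbsTopIProp410Sub.lean` (cofinality of PREIMAGES `f⁻¹(H′)` among the characteristic open `H ⊆ Δ^tp_X`)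
is SUSPECT-TOO-STRONG at the intended data (`f⁻¹(H′) ⊇ I_x`, while a characteristic `H` may omit the
inertia `I_x` of the removed cusp); it is NOT consumed as a hypothesis anywhere in this file — the
print-faithful form ([AbsTopI] §0 p. 8 compares the IMAGES in `Q = Π̂_Y`) is `CoFreeCofinalImAlong`
below. [cite: MochizukiAbsTopI2012, §0 p.8] -/
theorem coFreeCofinalAlong_ofConstruction_iff {X Y : TemperedCurve p} (E : DeCuspidalization X Y) :
    CoFreeCofinalAlong E (CoFreeQKit.ofConstruction X Y.PiHat E.fHat) ↔
      ∀ H : Subgroup X.PiTemp, IsCharOpenFiniteIndexInDelta X H →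
        ∃ H' : Subgroup Y.PiTemp, IsCharOpenFiniteIndexInDelta Y H' ∧ H'.comap E.f.toMonoidHom ≤ H :=
  ⟨fun h => h.1, fun h => ⟨h, fun _ _ _ _ hle => cofreeCore_mono hle⟩⟩

/-- **Row iii.L05, PRINT-FAITHFUL IMAGE FORM** (replaces the use of `CoFreeCofinalAlong` conjunct 1;
finding F-w5d011-1): the two directed families of closed normal subgroups of `Π̂_Y` —
`{Ĥ^{co-fr}_{Π̂_Y}}` for `H` ranging over the characteristic open subgroups of finite index of `Δ^tp_X`
(kernels of the `(Π̂_Y, Δ^tp_X)`-co-free completion of `Π^tp_X` along `f̂ ∘ toHat_X`), and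
`{Ĥ′^{co-fr}}` for `H′` ranging over those of `Δ^tp_Y` (kernels of the `(Π̂_Y, Δ^tp_Y)`-co-free
completion of `Π^tp_Y`, [AbsTopI] Prop 4.10 (i)) — are COFINAL in each other.  Together with
iii.L04 `CoFreeCompatAlong` (`f(H^{co-fr})` versus `H′^{co-fr}`) and iii.L03 (surjectivity of `f`, so
that the images `Im(Π^tp_X)` and `Im(Π^tp_Y)` in each `Π̂_Y/N` agree) this is what identifies the two
inverse limits of [AbsTopI] §0 p. 8, i.e. what "(iii) follows immediately from (i)" (p. 61) uses.
Named statement (model-level content). [cite: MochizukiAbsTopI2012, §0 p.8] -/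
def CoFreeCofinalImAlong {X Y : TemperedCurve p} (E : DeCuspidalization X Y) : Prop :=
  (∀ H : CharOpenSubgroup X.DeltaTemp, ∃ H' : CharOpenSubgroup Y.DeltaTemp,
      coFreeKernel ((ContinuousMonoidHom.id Y.PiHat).comp Y.toHat) H'.toSubgroup ≤
        coFreeKernel (E.fHat.comp X.toHat) H.toSubgroup) ∧
    ∀ H' : CharOpenSubgroup Y.DeltaTemp, ∃ H : CharOpenSubgroup X.DeltaTemp,
      coFreeKernel (E.fHat.comp X.toHat) H.toSubgroup ≤
        coFreeKernel ((ContinuousMonoidHom.id Y.PiHat).comp Y.toHat) H'.toSubgroup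

/-! ### The `l`-kit at the construction: `H[l]` with the action of normalisers -/

/-- `Ĥ ⊆ Π̂_X`: the closure of `toHat(H)` — the profinite completion of an open subgroup `H` of finite
index realised inside `Π̂_X` ([SemiAnbd] p. 73: "`∧` denotes profinite completion, or, equivalently,
closure in `Π_{X_K}`"; cf. `TemperedCurve.DeltaHat`). [cite: MochizukiAbsTopI2012, Prop 4.10 (iv) p.60] -/
def hatOf (X : TemperedCurve p) (H : Subgroup X.PiTemp) : Subgroup X.PiHat :=
  (H.map X.toHat.toMonoidHom).topologicalClosure

/-- `H → Ĥ`, the corestriction of `toHat`. [cite: MochizukiAbsTopI2012, Prop 4.10 (iv) p.60] -/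
def toHatOf (X : TemperedCurve p) (H : Subgroup X.PiTemp) : H →ₜ* hatOf X H where
  toFun h := ⟨X.toHat h, Subgroup.le_topologicalClosure _ ⟨h, h.2, rfl⟩⟩
  map_one' := Subtype.ext (by simp)
  map_mul' x y := Subtype.ext (by simp)
  continuous_toFun := (X.toHat.continuous.comp continuous_subtype_val).subtype_mk _

/-- Formula for `H → Ĥ`. [cite: MochizukiAbsTopI2012, Prop 4.10 (iv) p.60] -/
@[simp] theorem coe_toHatOf (X : TemperedCurve p) (H : Subgroup X.PiTemp) (h : H) :
    ((toHatOf X H h : hatOf X H) : X.PiHat) = X.toHat h := rfl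

/-- **`H[l]` at the construction**: the co-free completion of `H` with respect to the maximal pro-`l`
quotient of `Ĥ` (`CoFreeProL`, [AbsTopI] Prop 4.10 (iv) p. 60), for ANY subgroup `H` (meaningful for
`H ⊆ Δ^tp_X` open of finite index and `l` prime). [cite: MochizukiAbsTopI2012, Prop 4.10 (iv) p.60] -/
abbrev HlOf (X : TemperedCurve p) (H : Subgroup X.PiTemp) (l : ℕ) : Type :=
  CoFreeProL (toHatOf X H) l

/-- `ρ_{H,l} : H → Ĥ ↠ Ĥ^{(l)}`, the map along which `H[l]` is the co-free completion.
[cite: MochizukiAbsTopI2012, Prop 4.10 (iv) p.60] -/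
def rhoOf (X : TemperedCurve p) (H : Subgroup X.PiTemp) (l : ℕ) : H →ₜ* MaxProQuot (hatOf X H) l :=
  (toMaxProQuot (hatOf X H) l).comp (toHatOf X H)

section ConjAct

variable (X : TemperedCurve p) (H : Subgroup X.PiTemp)

/-- Conjugation by `j ∈ N(H)` on `H`, as an automorphism of the topological group `H`.
[cite: MochizukiAbsTopI2012, Prop 4.10 (v) p.61] -/
def conjOnH (j : X.PiTemp) (hj : j ∈ Subgroup.normalizer (H : Set X.PiTemp)) : H ≃ₜ* H :=
  restrictEquiv (conjEquiv j) H fun x => (Subgroup.mem_normalizer_iff.mp hj x).symm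

/-- Conjugation by `toHat j` preserves `Ĥ` for `j ∈ N(H)`. [cite: MochizukiAbsTopI2012, Prop 4.10 (v) p.61] -/
theorem conj_toHat_mem_hatOf_iff (j : X.PiTemp) (hj : j ∈ Subgroup.normalizer (H : Set X.PiTemp))
    (y : X.PiHat) : X.toHat j * y * (X.toHat j)⁻¹ ∈ hatOf X H ↔ y ∈ hatOf X H := by
  -- conjugation by `toHat g` maps `toHat(H)` into itself when `g` normalises `H`, hence its closure
  have key : ∀ (g : X.PiTemp), g ∈ Subgroup.normalizer (H : Set X.PiTemp) → ∀ y ∈ hatOf X H,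
      X.toHat g * y * (X.toHat g)⁻¹ ∈ hatOf X H := by
    intro g hg y hy
    have hs : Set.MapsTo (fun z : X.PiHat => X.toHat g * z * (X.toHat g)⁻¹)
        (H.map X.toHat.toMonoidHom : Set X.PiHat) (H.map X.toHat.toMonoidHom : Set X.PiHat) := by
      rintro _ ⟨h, hh, rfl⟩
      refine ⟨g * h * g⁻¹, (Subgroup.mem_normalizer_iff.mp hg h).mp hh, ?_⟩
      change X.toHat (g * h * g⁻¹) = X.toHat g * X.toHat h * (X.toHat g)⁻¹
      rw [map_mul, map_mul, map_inv]
    exact hs.closure ((continuous_const.mul continuous_id).mul continuous_const) hy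
  constructor
  · intro h
    have h' := key j⁻¹ (Subgroup.inv_mem _ hj) _ h
    rw [map_inv, inv_inv] at h'
    -- `toHat j⁻¹ * (toHat j * y * toHat j⁻¹) * toHat j = y`
    have : (X.toHat j)⁻¹ * (X.toHat j * y * (X.toHat j)⁻¹) * (X.toHat j) = y := by group
    rw [this] at h'
    exact h'
  · exact key j hj y

/-- Conjugation by `toHat j` on `Ĥ`, as an automorphism of the topological group `Ĥ`.
[cite: MochizukiAbsTopI2012, Prop 4.10 (v) p.61] -/
def conjOnHat (j : X.PiTemp) (hj : j ∈ Subgroup.normalizer (H : Set X.PiTemp)) :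
    hatOf X H ≃ₜ* hatOf X H :=
  restrictEquiv (conjEquiv (X.toHat j)) (hatOf X H) (conj_toHat_mem_hatOf_iff X H j hj)

/-- The automorphism of `Ĥ^{(l)}` induced by conjugation by `toHat j` (the pro-`l` kernel is
characteristic, `mem_proPrimeKer_iff_of_continuousMulEquiv`). [cite: MochizukiAbsTopI2012, Prop 4.10 (v) p.61] -/
def conjOnMaxProQuot (l : ℕ) (j : X.PiTemp) (hj : j ∈ Subgroup.normalizer (H : Set X.PiTemp)) :
    MaxProQuot (hatOf X H) l ≃ₜ* MaxProQuot (hatOf X H) l :=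
  quotientEquivOfInvariant (proPrimeKer (hatOf X H) l) (conjOnHat X H j hj)
    (mem_proPrimeKer_iff_of_continuousMulEquiv (hatOf X H) (conjOnHat X H j hj))

/-- `(conj(j)|_H, conj(toHat j)|_{Ĥ^{(l)}})` is an EQUIVARIANT PAIR for `ρ_{H,l}` (and `Δ := ⊤`).
[cite: MochizukiAbsTopI2012, Prop 4.10 (v) p.61] -/
theorem equivariance_conj (l : ℕ) (j : X.PiTemp) (hj : j ∈ Subgroup.normalizer (H : Set X.PiTemp)) :
    Equivariance (rhoOf X H l) (⊤ : Subgroup H) (conjOnH X H j hj) (conjOnMaxProQuot X H l j hj) where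
  mem_iff _ := by simp
  comm x := by
    change quotientEquivOfInvariant _ _ _ ((toHatOf X H x : hatOf X H) : MaxProQuot (hatOf X H) l) =
      ((toHatOf X H (conjOnH X H j hj x) : hatOf X H) : MaxProQuot (hatOf X H) l)
    rw [quotientEquivOfInvariant_mk]
    congr 1
    apply Subtype.ext
    change X.toHat j * X.toHat x * (X.toHat j)⁻¹ = X.toHat (j * x * j⁻¹)
    rw [map_mul, map_mul, map_inv]

/-- The endomorphism of `H[l]` induced by conjugation by `j ∈ N(H)` ("the outer action of `J` on
`H[l]`", [AbsTopI] Prop 4.10 (v) p. 61), via functoriality of the co-free completion.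
[cite: MochizukiAbsTopI2012, Prop 4.10 (v) p.61] -/
def conjActOf (l : ℕ) (j : X.PiTemp) (hj : j ∈ Subgroup.normalizer (H : Set X.PiTemp)) :
    HlOf X H l →* HlOf X H l :=
  (equivariance_conj X H l j hj).congrHom.toMonoidHom

/-- `conjAct j (η h) = η (j h j⁻¹)` at the construction (`Equivariance.congrHom_toCoFreeCompletion`).
[cite: MochizukiAbsTopI2012, Prop 4.10 (v) p.61] -/
theorem conjActOf_η (l : ℕ) (j : X.PiTemp) (hj : j ∈ Subgroup.normalizer (H : Set X.PiTemp)) (h : H) :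
    conjActOf X H l j hj (toCoFreeProL (toHatOf X H) l h) =
      toCoFreeProL (toHatOf X H) l ⟨j * (h : X.PiTemp) * j⁻¹,
        (Subgroup.mem_normalizer_iff.mp hj (h : X.PiTemp)).mp h.2⟩ :=
  (equivariance_conj X H l j hj).congrHom_toCoFreeCompletion h

/-- `H` acts INNERLY on `H[l]` at the construction (`Equivariance.congrHom_eq_conj_of`).
[cite: MochizukiAbsTopI2012, Prop 4.10 (v) p.61] -/
theorem conjActOf_inner (l : ℕ) (h : X.PiTemp) (hh : h ∈ H) (x : HlOf X H l) :
    conjActOf X H l h (Subgroup.le_normalizer hh) x =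
      toCoFreeProL (toHatOf X H) l ⟨h, hh⟩ * x * (toCoFreeProL (toHatOf X H) l ⟨h, hh⟩)⁻¹ := by
  refine (equivariance_conj X H l h (Subgroup.le_normalizer hh)).congrHom_eq_conj_of ⟨h, hh⟩ ?_ x
  intro q
  obtain ⟨y, rfl⟩ := QuotientGroup.mk_surjective q
  change quotientEquivOfInvariant _ _ _ (y : MaxProQuot (hatOf X H) l) = _
  rw [quotientEquivOfInvariant_mk]
  rfl

end ConjAct

/-- **`CoFreeLKit` INSTANTIATED**: `(H, l) ↦ H[l]` with its natural map and the conjugation action of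
normalisers, all from the construction; the kit's laws `conjAct_η` / `conjAct_inner` are the theorems
`conjActOf_η` / `conjActOf_inner`.  Closes TODO-merge:abc-iut-L4-t13 of `AbsTopIProp410Sub.lean`.
[cite: MochizukiAbsTopI2012, Prop 4.10 (iv) p.60] -/
def CoFreeLKit.ofConstruction (X : TemperedCurve p) : CoFreeLKit X where
  Hl H l := HlOf X H l
  η H l := (toCoFreeProL (toHatOf X H) l).toMonoidHom
  conjAct H l j hj := conjActOf X H l j hj
  conjAct_η H l j hj h := conjActOf_η X H l j hj h
  conjAct_inner H l h hh x := conjActOf_inner X H l h hh x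

/-- At the construction, every `η : H → H[l]` has dense image ([AbsTopI] §0 p. 8).
[cite: MochizukiAbsTopI2012, Prop 4.10 (iv) p.60] -/
theorem CoFreeLKit.denseRange_η_ofConstruction (X : TemperedCurve p) (H : Subgroup X.PiTemp) (l : ℕ) :
    DenseRange ((CoFreeLKit.ofConstruction X).η H l) :=
  denseRange_toCoFreeProL (toHatOf X H) l

/-! ### [AbsTopI] Prop 4.10 (v) at the construction -/

/-- The predicate of [AbsTopI] Prop 4.10 (v) p. 61 AT THE CONSTRUCTION (`H[l]` := `HlOf`).
[cite: MochizukiAbsTopI2012, Prop 4.10 (v) p.61] -/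
def CharacterisesPAt (X : TemperedCurve p) (l : ℕ) : Prop :=
  CharacterisesP (CoFreeLKit.ofConstruction X) l

/-- **[AbsTopI] Prop 4.10 (v) AT THE CONSTRUCTION** (node `AbsTopI:Prop4.10(v)`, p. 61): "The prime
number `p` may be characterized — "group-theoretically" — as the unique prime number `l` such that"
`CharacterisesPAt X l`.  Named statement; by `prop410v_of_rows` it follows from the four rows of the
sub-DAG for any reduction-graph kit over `CoFreeLKit.ofConstruction X` (`prop410vAt_of_rows`).
[cite: MochizukiAbsTopI2012, Prop 4.10 (v) p.61] -/
def Prop410vAt (X : TemperedCurve p) : Prop :=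
  Prop410v (CoFreeLKit.ofConstruction X)

/-- The sub-DAG assembly AT THE CONSTRUCTION: rows ⟹ Prop 4.10 (v) (w5-d025's `prop410v_of_rows`,
specialised). [cite: MochizukiAbsTopI2012, Prop 4.10 (v) p.61] -/
theorem prop410vAt_of_rows (X : TemperedCurve p) (R : ReductionGraphKit X (CoFreeLKit.ofConstruction X))
    (h2 : MaxCompactAreVerticial (CoFreeLKit.ofConstruction X) R)
    (h3 : FixesOfOuterTrivial (CoFreeLKit.ofConstruction X) R)
    (h4 : VertexInertiaPPower (CoFreeLKit.ofConstruction X) R)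
    (h5 : ExistsInertPCovering (CoFreeLKit.ofConstruction X) R) : Prop410vAt X :=
  prop410v_of_rows _ R h2 h3 h4 h5

end Literature.AnabelianGeometry.AbsoluteAnabelian.AbsTopI.Prop410
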